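/-
Origin: expansion seat `planner-pub-hodgecm-pv11-0`, handover 2026-08-18T03:44:48Z (`HOME/pub-hodgecm-pv11/lean/Pv11/ThetaPeriodCont.lean`, md5 4139064e, 248 lines);
landed by the gen-5 packager in gate run 19 as `HodgeCM/PerL34/ThetaPeriodCont.lean` (verbatim).
-/
/-
Copyright: pub-hodgecm cell, 2026-08-18.  Seat pv11 (planner-pub-hodgecm-pv11-0), DAG node N18.
-/
import Mathlib.Topology.ContinuousMap.Compact
import Mathlib.Topology.CompactOpen
import Mathlib.MeasureTheory.Integral.Bochner.Basic
import Mathlib.MeasureTheory.Constructions.BorelSpace.Basic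
import Mathlib.MeasureTheory.Function.LpSpace.ContinuousFunctions
import Mathlib.Analysis.Complex.Basic

/-!
# N18 — PerL v5 §3.3 set-up (tex ll. 341–349): `ϑ_{T,χ₁₂}(Φ) ∈ C([G_U])`, a continuous function of `Φ`; `S₁₂`

VERBATIM (PerL v5 `paper.tex` ll. 341–349):

> From now on `𝒮 = 𝒮((V₃⊗W)(𝔸))` denotes the full Schwartz–Bruhat space (Schwartz functions at the archimedean
> places, locally constant compactly supported at the finite ones), on which `ω = ω_{W,μ_W}` is a continuous
> representation of `U(W)(𝔸) × G_U(𝔸)`; the `K`-finite (Fock) vectors used so far are dense, and `Φ ↦ θ_Φ` is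
> continuous from `𝒮` to `C([G_U]×[U(W)])` (uniform norm). Let `κ` be the character `∧²𝔭₊ ⊠ 1` of `K_∞`
> and `𝒮^κ` the `κ`-isotypic subspace of `𝒮` for `ω|_{K_∞}`. For `(T,χ₁₂)` from an allowed pair and
> `Φ ∈ 𝒮` put `ϑ_{T,χ₁₂}(Φ) := ∫_{[T]} θ_Φ(·,t) χ₁₂(t) dt ∈ C([G_U])`, a continuous
> function of `Φ`, and define the closed subspaces of `L²([G_U])`
>   `S₁₂ := closure span {ϑ_{T,χ₁₂}(Φ) : Φ ∈ 𝒮^κ, (T,χ₁₂) from an allowed pair of type (12)}`, `S₃₄` likewise.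

KIND: **L2 (honest split)**.  The carver typed N18 as `N18_thetaCont` = the POSITED field `AX5b_ϑ_cont` of the
frozen prior interface.  Here the functional-analytic step that PerL leaves implicit is KERNEL-PROVED in Mathlib
generality, and the two PRINT/definitional inputs stay labelled hypotheses / data:

* KERNEL (Mathlib generality, nothing posited):
  - `periodFunctional ν χ : C(T, ℂ) →L[ℂ] ℂ`, `f ↦ ∫_T f(t) χ(t) dν(t)`, with
    `‖periodFunctional ν χ f‖ ≤ ‖χ‖ · ν(T) · ‖f‖` (`T` compact, `ν` a finite Borel measure, `χ ∈ C(T, ℂ)`);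
  - `periodMap ν i χ : C(X × Y, ℂ) →L[ℂ] C(X, ℂ)`, `F ↦ (x ↦ ∫_T F(x, i t) χ(t) dν(t))` for `X` compact
    (`= [G_U]`), `Y` (`= [U(W)]`) any space and `i : C(T, Y)` (`= [T] → [U(W)]`, `t ↦ T(L₀)t`): the value IS a
    continuous function on `X` (`periodMap_apply`), the map is ℂ-linear and bounded,
    `‖periodMap ν i χ F‖ ≤ ‖χ‖ · ν(T) · ‖F‖` (`norm_periodMap_le`).  This is exactly "`ϑ_{T,χ₁₂}(Φ) ∈ C([G_U])`,
    a continuous function of `Φ`" granted the continuity of `Φ ↦ θ_Φ` into `C([G_U]×[U(W)])`: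
  - `thetaPeriod θ ν i χ := (periodMap ν i χ).comp θ : 𝒮 →L[ℂ] C([G_U])` for ANY continuous linear
    `θ : 𝒮 →L[ℂ] C([G_U]×[U(W)])` on any topological ℂ-module `𝒮` (`thetaPeriod_apply`, `continuous_thetaPeriod`),
    and its image in `L²([G_U])` through the bounded map `C([G_U]) → L²([G_U])` (`ContinuousMap.toLp`, Mathlib),
    `thetaPeriodL2`, is again continuous linear — so the generators of `S₁₂` depend continuously on `Φ`.
* PRINT (hypothesis = the datum `θ : 𝒮 →L[ℂ] C([G_U]×[U(W)], ℂ)`): "`Φ ↦ θ_Φ` is continuous from `𝒮` to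
  `C([G_U]×[U(W)])` (uniform norm)" and linear — A. Weil, *Sur certains groupes d'opérateurs unitaires*, Acta Math.
  111 (1964) 143–211 (continuity of the theta distribution on the Schwartz–Bruhat space; the automorphic kernel
  `θ_Φ(g,h)` is continuous on the compact space `[G_U]×[U(W)]`, PerL l. 394); compactness of `[G_U]`, `[U(W)]`
  (anisotropic groups, PerL l. 384) is the instance hypothesis `CompactSpace`; finiteness of `dt` on the compact
  `[T]` is `IsFiniteMeasure`.
* DEFINITIONAL (data, not retyped here): `κ`, `𝒮^κ`, "allowed", and `S₁₂ := closure span {…}` — typed by pv14 as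
  `HodgeCM.PerL34.P36Unfolding.Step1Data.S12` (closed span of the generators `ϑ χ Φ'`, `Φ' ∈ 𝒮^κ`, `χ` allowed);
  the generator map there, `ϑ : Ch → SK → H`, is what `thetaPeriodL2` below constructs from `θ`.

No divergence from the tex; no gap.  (The density of `K`-finite vectors and the continuity of `ω` on `𝒮` are
not used in this paragraph's deductions; they are PRINT facts consumed later, N19/N23.)
-/

set_option autoImplicit false

open MeasureTheory
open scoped BigOperators

namespace HodgeCM.PerL34.ThetaPeriodCont

section PeriodFunctional

variable {T : Type*} [TopologicalSpace T] [CompactSpace T] [MeasurableSpace T] [OpensMeasurableSpace T]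
  (ν : Measure T) [IsFiniteMeasure ν] (χ : C(T, ℂ))

omit [MeasurableSpace T] [OpensMeasurableSpace T] in
/-- Pointwise bound for the period integrand: `‖f(t) χ(t)‖ ≤ ‖f‖ ‖χ‖`. -/
theorem norm_mul_apply_le (f : C(T, ℂ)) (t : T) : ‖f t * χ t‖ ≤ ‖f‖ * ‖χ‖ := by
  rw [norm_mul]
  exact mul_le_mul (f.norm_coe_le_norm t) (χ.norm_coe_le_norm t) (norm_nonneg _) (norm_nonneg _)

/-- The integrand `t ↦ f(t) χ(t)` is integrable (continuous on a compact space, finite measure). -/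
theorem integrable_mul (f : C(T, ℂ)) : Integrable (fun t => f t * χ t) ν := by
  have hcont : Continuous fun t => f t * χ t := by fun_prop
  exact ⟨hcont.aestronglyMeasurable,
    HasFiniteIntegral.of_bounded (C := ‖f‖ * ‖χ‖) (Filter.Eventually.of_forall (norm_mul_apply_le χ f))⟩

/-- `P_χ(f) := ∫_T f(t) χ(t) dν(t)` as a ℂ-linear map on `C(T, ℂ)`. -/
noncomputable def periodFunctionalₗ : C(T, ℂ) →ₗ[ℂ] ℂ where
  toFun f := ∫ t, f t * χ t ∂ν
  map_add' f g := by
    simp only [ContinuousMap.add_apply, add_mul]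
    exact integral_add (integrable_mul ν χ f) (integrable_mul ν χ g)
  map_smul' c f := by
    simp only [ContinuousMap.smul_apply, smul_eq_mul, mul_assoc, RingHom.id_apply]
    exact integral_const_mul c _

/-- (Ported verbatim from the HodgeCMPerL package; no docstring in the source.) -/
theorem norm_periodFunctionalₗ_le (f : C(T, ℂ)) :
    ‖periodFunctionalₗ ν χ f‖ ≤ ‖χ‖ * ν.real Set.univ * ‖f‖ := by
  have h := norm_integral_le_of_norm_le_const (μ := ν) (f := fun t => f t * χ t) (C := ‖f‖ * ‖χ‖)
    (Filter.Eventually.of_forall (norm_mul_apply_le χ f))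
  calc ‖periodFunctionalₗ ν χ f‖ = ‖∫ t, f t * χ t ∂ν‖ := rfl
    _ ≤ ‖f‖ * ‖χ‖ * ν.real Set.univ := h
    _ = ‖χ‖ * ν.real Set.univ * ‖f‖ := by ring

/-- **KERNEL:** the period functional `f ↦ ∫_T f χ dν` is a bounded linear functional on `C(T, ℂ)`,
of norm `≤ ‖χ‖ · ν(T)`. -/
noncomputable def periodFunctional : C(T, ℂ) →L[ℂ] ℂ :=
  (periodFunctionalₗ ν χ).mkContinuous (‖χ‖ * ν.real Set.univ) (norm_periodFunctionalₗ_le ν χ)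

/-- (Ported verbatim from the HodgeCMPerL package; no docstring in the source.) -/
@[simp] theorem periodFunctional_apply (f : C(T, ℂ)) :
    periodFunctional ν χ f = ∫ t, f t * χ t ∂ν := rfl

/-- (Ported verbatim from the HodgeCMPerL package; no docstring in the source.) -/
theorem norm_periodFunctional_apply_le (f : C(T, ℂ)) :
    ‖periodFunctional ν χ f‖ ≤ ‖χ‖ * ν.real Set.univ * ‖f‖ :=
  norm_periodFunctionalₗ_le ν χ f

end PeriodFunctional

section PeriodMap

variable {X Y T : Type*} [TopologicalSpace X] [CompactSpace X] [TopologicalSpace Y] [CompactSpace Y]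
  [TopologicalSpace T] [CompactSpace T] [MeasurableSpace T] [OpensMeasurableSpace T]
  (ν : Measure T) [IsFiniteMeasure ν] (i : C(T, Y)) (χ : C(T, ℂ))

/-- Restriction of `F ∈ C(X × Y)` along `x` and `i : T → Y`: the continuous map `x ↦ (t ↦ F(x, i t))`,
`X → C(T, ℂ)` (currying; no local compactness needed). -/
noncomputable def sliceAlong (F : C(X × Y, ℂ)) : C(X, C(T, ℂ)) :=
  (F.comp ((ContinuousMap.id X).prodMap i)).curry

omit [CompactSpace X] [CompactSpace Y] [CompactSpace T] [MeasurableSpace T] [OpensMeasurableSpace T] in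
/-- (Ported verbatim from the HodgeCMPerL package; no docstring in the source.) -/
@[simp] theorem sliceAlong_apply (F : C(X × Y, ℂ)) (x : X) (t : T) :
    sliceAlong i F x t = F (x, i t) := rfl

omit [MeasurableSpace T] [OpensMeasurableSpace T] in
/-- (Ported verbatim from the HodgeCMPerL package; no docstring in the source.) -/
theorem norm_sliceAlong_le (F : C(X × Y, ℂ)) (x : X) : ‖sliceAlong i F x‖ ≤ ‖F‖ := by
  refine (ContinuousMap.norm_le _ (norm_nonneg F)).2 fun t => ?_
  rw [sliceAlong_apply]
  exact F.norm_coe_le_norm (x, i t)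

/-- The period of `F ∈ C(X × Y, ℂ)` along `(T, ν, i, χ)` as a CONTINUOUS function of `x ∈ X`:
`x ↦ ∫_T F(x, i t) χ(t) dν(t)` (continuity: composition of the continuous slice map with the bounded period
functional). -/
noncomputable def periodMapFun (F : C(X × Y, ℂ)) : C(X, ℂ) :=
  ⟨fun x => periodFunctional ν χ (sliceAlong i F x),
    (periodFunctional ν χ).continuous.comp (sliceAlong i F).continuous⟩

omit [CompactSpace X] [CompactSpace Y] in
/-- (Ported verbatim from the HodgeCMPerL package; no docstring in the source.) -/
@[simp] theorem periodMapFun_apply (F : C(X × Y, ℂ)) (x : X) :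
    periodMapFun ν i χ F x = ∫ t, F (x, i t) * χ t ∂ν := rfl

/-- Linear version. -/
noncomputable def periodMapₗ : C(X × Y, ℂ) →ₗ[ℂ] C(X, ℂ) where
  toFun := periodMapFun ν i χ
  map_add' F G := by
    ext x
    change periodFunctional ν χ (sliceAlong i (F + G) x) =
      periodFunctional ν χ (sliceAlong i F x) + periodFunctional ν χ (sliceAlong i G x)
    rw [← map_add]
    rfl
  map_smul' c F := by
    ext x
    change periodFunctional ν χ (sliceAlong i (c • F) x) = c • periodFunctional ν χ (sliceAlong i F x)
    rw [← map_smul]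
    rfl

/-- (Ported verbatim from the HodgeCMPerL package; no docstring in the source.) -/
theorem norm_periodMapₗ_le (F : C(X × Y, ℂ)) : ‖periodMapₗ ν i χ F‖ ≤ ‖χ‖ * ν.real Set.univ * ‖F‖ := by
  refine (ContinuousMap.norm_le _ (by positivity)).2 fun x => ?_
  calc ‖periodMapₗ ν i χ F x‖ = ‖periodFunctional ν χ (sliceAlong i F x)‖ := rfl
    _ ≤ ‖χ‖ * ν.real Set.univ * ‖sliceAlong i F x‖ := norm_periodFunctional_apply_le ν χ _
    _ ≤ ‖χ‖ * ν.real Set.univ * ‖F‖ := by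
        gcongr
        exact norm_sliceAlong_le i F x

/-- **KERNEL (the functional-analytic content of N18):** the period map
`P_{T,χ} : C(X × Y, ℂ) →L[ℂ] C(X, ℂ)`, `F ↦ (x ↦ ∫_T F(x, i t) χ(t) dν(t))`, is a bounded linear map of norm
`≤ ‖χ‖ · ν(T)`.  With `X = [G_U]`, `Y = [U(W)]`, `T = [T]`, `F = θ_Φ`: `ϑ_{T,χ₁₂}(Φ) = P_{T,χ₁₂}(θ_Φ) ∈ C([G_U])`. -/
noncomputable def periodMap : C(X × Y, ℂ) →L[ℂ] C(X, ℂ) :=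
  (periodMapₗ ν i χ).mkContinuous (‖χ‖ * ν.real Set.univ) (norm_periodMapₗ_le ν i χ)

/-- (Ported verbatim from the HodgeCMPerL package; no docstring in the source.) -/
@[simp] theorem periodMap_apply (F : C(X × Y, ℂ)) (x : X) :
    periodMap ν i χ F x = ∫ t, F (x, i t) * χ t ∂ν := rfl

/-- (Ported verbatim from the HodgeCMPerL package; no docstring in the source.) -/
theorem norm_periodMap_le (F : C(X × Y, ℂ)) : ‖periodMap ν i χ F‖ ≤ ‖χ‖ * ν.real Set.univ * ‖F‖ :=
  norm_periodMapₗ_le ν i χ F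

/-- (Ported verbatim from the HodgeCMPerL package; no docstring in the source.) -/
theorem continuous_periodMap : Continuous (periodMap (X := X) ν i χ) := (periodMap (X := X) ν i χ).continuous

end PeriodMap

section N18

variable {S X Y T : Type*} [TopologicalSpace S] [AddCommGroup S] [Module ℂ S]
  [TopologicalSpace X] [CompactSpace X] [TopologicalSpace Y] [CompactSpace Y]
  [TopologicalSpace T] [CompactSpace T] [MeasurableSpace T] [OpensMeasurableSpace T]

/-- `ϑ_{T,χ}(Φ) := ∫_{[T]} θ_Φ(·,t) χ(t) dt ∈ C([G_U])` as a continuous linear map of `Φ ∈ 𝒮`, for a given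
continuous linear theta map `θ : 𝒮 →L[ℂ] C([G_U]×[U(W)], ℂ)` (PRINT datum), the measure `dt` on `[T]`,
`i : [T] → [U(W)]` and the character `χ = χ₁₂`. -/
noncomputable def thetaPeriod (θ : S →L[ℂ] C(X × Y, ℂ)) (ν : Measure T) [IsFiniteMeasure ν] (i : C(T, Y))
    (χ : C(T, ℂ)) : S →L[ℂ] C(X, ℂ) :=
  (periodMap ν i χ).comp θ

/-- **N18, the displayed definition (tex l. 346), verbatim as a formula:**
`ϑ_{T,χ}(Φ)(g) = ∫_{[T]} θ_Φ(g,t) χ(t) dt`. -/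
theorem thetaPeriod_apply (θ : S →L[ℂ] C(X × Y, ℂ)) (ν : Measure T) [IsFiniteMeasure ν] (i : C(T, Y))
    (χ : C(T, ℂ)) (Φ : S) (g : X) :
    thetaPeriod θ ν i χ Φ g = ∫ t, θ Φ (g, i t) * χ t ∂ν := rfl

/-- **N18 (tex l. 346–347): "`ϑ_{T,χ₁₂}(Φ) ∈ C([G_U])`, a continuous function of `Φ`"** — KERNEL-PROVED from
the PRINT continuity of `Φ ↦ θ_Φ` (encoded in the type of `θ`). -/
theorem continuous_thetaPeriod (θ : S →L[ℂ] C(X × Y, ℂ)) (ν : Measure T) [IsFiniteMeasure ν] (i : C(T, Y))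
    (χ : C(T, ℂ)) : Continuous fun Φ : S => (thetaPeriod θ ν i χ Φ : C(X, ℂ)) :=
  (thetaPeriod θ ν i χ).continuous

/-- Uniform bound: `‖ϑ_{T,χ}(Φ)‖_∞ ≤ ‖χ‖_∞ · vol([T]) · ‖θ_Φ‖_∞`. -/
theorem norm_thetaPeriod_le (θ : S →L[ℂ] C(X × Y, ℂ)) (ν : Measure T) [IsFiniteMeasure ν] (i : C(T, Y))
    (χ : C(T, ℂ)) (Φ : S) : ‖thetaPeriod θ ν i χ Φ‖ ≤ ‖χ‖ * ν.real Set.univ * ‖θ Φ‖ :=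
  norm_periodMap_le ν i χ (θ Φ)

variable [MeasurableSpace X] [BorelSpace X]

/-- The generators of `S₁₂` live in `L²([G_U])`: `Φ ↦ ϑ_{T,χ}(Φ)` followed by the bounded inclusion
`C([G_U]) → L²([G_U], dg)` (Mathlib `ContinuousMap.toLp`), again a continuous linear map of `Φ`
(tex ll. 347–348: "define the closed subspaces of `L²([G_U])` `S₁₂ := closure span {ϑ_{T,χ₁₂}(Φ) : …}`"). -/
noncomputable def thetaPeriodL2 (θ : S →L[ℂ] C(X × Y, ℂ)) (ν : Measure T) [IsFiniteMeasure ν] (i : C(T, Y))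
    (χ : C(T, ℂ)) (μ : Measure X) [IsFiniteMeasure μ] : S →L[ℂ] Lp ℂ 2 μ :=
  (ContinuousMap.toLp (E := ℂ) 2 μ ℂ).comp (thetaPeriod θ ν i χ)

/-- (Ported verbatim from the HodgeCMPerL package; no docstring in the source.) -/
theorem continuous_thetaPeriodL2 (θ : S →L[ℂ] C(X × Y, ℂ)) (ν : Measure T) [IsFiniteMeasure ν]
    (i : C(T, Y)) (χ : C(T, ℂ)) (μ : Measure X) [IsFiniteMeasure μ] :
    Continuous fun Φ : S => thetaPeriodL2 θ ν i χ μ Φ :=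
  (thetaPeriodL2 θ ν i χ μ).continuous

/-- `S₁₂` (tex l. 348) over this vocabulary, DEFINITIONAL: the closure of the span of the generators
`ϑ_{T,χ}(Φ) ∈ L²([G_U])` for `Φ` in the `κ`-isotypic set `Sκ ⊆ 𝒮` and `(T, i, χ)` running over an index set
`A` of allowed pairs (each allowed pair `a` carrying its torus data `ν a, i a, χ a` on a common compact
parameter space — or take `A` a singleton per pair and sum the spans; the closure-of-span shape is what matters). -/
noncomputable def S12 (θ : S →L[ℂ] C(X × Y, ℂ)) (μ : Measure X) [IsFiniteMeasure μ] (Sκ : Set S)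
    {A : Type*} (ν : A → Measure T) [∀ a, IsFiniteMeasure (ν a)] (i : A → C(T, Y)) (χ : A → C(T, ℂ)) :
    Submodule ℂ (Lp ℂ 2 μ) :=
  (Submodule.span ℂ {v | ∃ a, ∃ Φ ∈ Sκ, v = thetaPeriodL2 θ (ν a) (i a) (χ a) μ Φ}).topologicalClosure

/-- (Ported verbatim from the HodgeCMPerL package; no docstring in the source.) -/
theorem isClosed_S12 (θ : S →L[ℂ] C(X × Y, ℂ)) (μ : Measure X) [IsFiniteMeasure μ] (Sκ : Set S)
    {A : Type*} (ν : A → Measure T) [∀ a, IsFiniteMeasure (ν a)] (i : A → C(T, Y)) (χ : A → C(T, ℂ)) :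
    IsClosed (S12 θ μ Sκ ν i χ : Set (Lp ℂ 2 μ)) :=
  Submodule.isClosed_topologicalClosure _

/-- (Ported verbatim from the HodgeCMPerL package; no docstring in the source.) -/
theorem generator_mem_S12 (θ : S →L[ℂ] C(X × Y, ℂ)) (μ : Measure X) [IsFiniteMeasure μ] (Sκ : Set S)
    {A : Type*} (ν : A → Measure T) [∀ a, IsFiniteMeasure (ν a)] (i : A → C(T, Y)) (χ : A → C(T, ℂ))
    (a : A) {Φ : S} (hΦ : Φ ∈ Sκ) :
    thetaPeriodL2 θ (ν a) (i a) (χ a) μ Φ ∈ S12 θ μ Sκ ν i χ :=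
  Submodule.le_topologicalClosure _ (Submodule.subset_span ⟨a, Φ, hΦ, rfl⟩)

end N18

end HodgeCM.PerL34.ThetaPeriodCont
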